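import Literature.AlgebraicGeometry.Resolution.PthRootDerivationRegular
import Literature.AlgebraicGeometry.Resolution.RegularLocalRingsProofs
import Mathlib.RingTheory.Localization.AtPrime.Basic
import Mathlib.RingTheory.Ideal.GoingUp
import HarnessLib

/-!
# Crux `Steer` (stmt-ResolutionOfSingularities-16345), chain W4.1: LOCALISING THE TORSOR GERM `R[T]/(T^p − f)` AT A PRIME
# (`B_{P'} ≅ R_Q[T]/(T^p − f)` up to regularity, BOTH directions; Theses-free, definition-free plumbing)

OURS (campaign `res-hironaka`, rung L ★L-G4, slot W4.1; seat res-D-pv-004 AS res-L0-w41-stub-10; replaces the role of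
no printed item and is NOT a statement of the manuscript under review [claim: Hironaka2017, status: under-review];
AI-produced, weaker than expert review). Part 1 of 2 of the Jacobian criterion for `p`-radicand germs
(`FrobeniusClosingSteerJacobianCriterionFormal.lean`), split off by the 400-line rule.

For a ring `R` of characteristic `p`, `f ∈ R`, `B := R[T]/(T^p − f)` (`AdjoinRoot (X ^ p − C f)`, the W4.1 sketches'
`RadicandRing R p f`), a prime `P'` of `B` and `Q := P' ∩ R`:

* `isRegularLocalRing_localization_atPrime_iff_of_monic` / `…_iff_of_under_eq` — **`B_{P'}` is a regular local ring iff
  the torsor germ `C := R_Q[T]/(T^p − f)` over the local ring `R_Q` is.** `C` is the localisation of `B` at the image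
  `N` of `R ∖ Q` (`Polynomial.isLocalization`, `IsLocalization.of_surjective`), `N` misses `P'`, the prime `P'C` lies
  over `Q R_Q` and is therefore THE maximal ideal of the local ring `C` (`isLocalRing_adjoinRoot_X_pow_sub_C_of_charP`,
  integrality), and `B_{P'} ≅ C_{P'C} ≅ C`. (The regular-if half alone is (g2)
  `GeoDict.isRegularLocalRing_localization_atPrime_adjoinRoot_of_under_eq` of res-type-096 / res-D-pv-011, stated there
  over an intermediate localisation; this file gives the equivalence over `R` itself.)
* `under_ne_maximalIdeal_of_exists_lt`, `exists_prime_under_eq_of_ne_maximalIdeal` — over a LOCAL base `R`, the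
  NON-maximal primes of `B` are exactly the primes over non-maximal primes of `R` (integrality; lying over for the
  injective integral extension `R → B` when `R` is a domain). So `HasIsolatedSingularity (RadicandRing R p f)` is a
  statement about the germs `R_Q[T]/(T^p − f)`, `Q ≠ 𝔪_R`.

[cite: Matsumura1987, Thm. 19.3] for the only non-formal input (Serre: localisations of regular local rings are
regular, used through `IsRegularLocalRing.of_ringEquiv` transport only). bears_on: LADDER-RESOLUTION L ★L-G4 W4.1.
-/

noncomputable section

-- `Summit.<S>.<S>.…` duplicates the summit name by design (single-problem summit).
set_option linter.dupNamespace false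

open IsLocalRing

namespace Summit.ResolutionOfSingularities.ResolutionOfSingularities.Theorems.SwitchingDichotomy.RadicandLocalization

open Literature.AlgebraicGeometry.Resolution

universe u v

/-! ## §2 Localising the torsor germ `R[T]/(T^p − f)` at a prime: `B_{P'} ≅ R_Q[T]/(T^p − f)` -/

section Localization

open Polynomial

variable {R : Type u} [CommRing R] (p : ℕ) [Fact p.Prime] (f : R) (Q : Ideal R) [Q.IsPrime]

/-- `CharP` passes to the localisation at a prime (a local, hence nontrivial, ring in which `p = 0`).
[folklore] -/
theorem charP_localization_atPrime [CharP R p] : CharP (Localization.AtPrime Q) p := by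
  have h0 : ((p : ℕ) : Localization.AtPrime Q) = 0 := by
    rw [← map_natCast (algebraMap R (Localization.AtPrime Q)) p, CharP.cast_eq_zero, map_zero]
  exact (CharP.charP_iff_prime_eq_zero Fact.out).mpr h0

/-- **`B_{P'} ≅ R_Q[T]/(g)` up to regularity** (core, for a monic `g`). Let `B := R[T]/(g)`, `P'` a prime of `B`,
`Q := P' ∩ R`, and suppose the base change `C := R_Q[T]/(g)` is a LOCAL ring. Then `B_{P'}` is a regular local ring iff
`C` is: `C` is the localisation of `B` at the image `N` of `R ∖ Q` (`Polynomial.isLocalization`,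
`IsLocalization.of_surjective`), `N` misses `P'`, the prime `P'C` lies over the maximal ideal of `R_Q` and is therefore
THE maximal ideal of `C` (integrality), and `B_{P'} ≅ C_{P'C} ≅ C`. OURS (plumbing; the regular half is (g2)
`GeoDict.isRegularLocalRing_localization_atPrime_adjoinRoot_of_under_eq`, res-type-096 / res-D-pv-011).
[cite: Matsumura1987, Thm. 19.3] -/
theorem isRegularLocalRing_localization_atPrime_iff_of_monic (g : R[X]) (hgm : g.Monic)
    [hCloc : IsLocalRing (AdjoinRoot (g.map (algebraMap R (Localization.AtPrime Q))))]
    (P' : Ideal (AdjoinRoot g)) [P'.IsPrime] (hQ : P'.under R = Q) :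
    IsRegularLocalRing (Localization.AtPrime P') ↔
      IsRegularLocalRing (AdjoinRoot (g.map (algebraMap R (Localization.AtPrime Q)))) := by
  classical
  set g' : (Localization.AtPrime Q)[X] := g.map (algebraMap R (Localization.AtPrime Q)) with hg'
  -- polynomial rings
  letI algPoly : Algebra R[X] (Localization.AtPrime Q)[X] := Polynomial.algebra R (Localization.AtPrime Q)
  haveI hlocPoly : IsLocalization (Q.primeCompl.map (C : R →+* R[X])) (Localization.AtPrime Q)[X] :=
    Polynomial.isLocalization _ (Localization.AtPrime Q)
  -- the comparison map `ψ : B → C`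
  have hroot : g.eval₂ ((AdjoinRoot.of g').comp (algebraMap R (Localization.AtPrime Q))) (AdjoinRoot.root g') = 0 := by
    rw [← Polynomial.eval₂_map, ← hg']
    exact AdjoinRoot.eval₂_root g'
  let ψ : AdjoinRoot g →+* AdjoinRoot g' :=
    AdjoinRoot.lift ((AdjoinRoot.of g').comp (algebraMap R (Localization.AtPrime Q))) (AdjoinRoot.root g') hroot
  letI algBC : Algebra (AdjoinRoot g) (AdjoinRoot g') := ψ.toAlgebra
  have hψ : algebraMap (AdjoinRoot g) (AdjoinRoot g') = ψ := rfl
  have hψof : ∀ r : R, ψ (AdjoinRoot.of g r) = AdjoinRoot.of g' (algebraMap R (Localization.AtPrime Q) r) := by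
    intro r
    change (AdjoinRoot.lift _ _ hroot) (AdjoinRoot.of g r) = _
    rw [AdjoinRoot.lift_of, RingHom.comp_apply]
  -- `C` is the localisation of `B` at `N := image of R ∖ Q` (quotients commute with localisation)
  have H : (AdjoinRoot.mk g').comp (algebraMap R[X] (Localization.AtPrime Q)[X]) =
      (algebraMap (AdjoinRoot g) (AdjoinRoot g')).comp (AdjoinRoot.mk g) := by
    apply Polynomial.ringHom_ext
    · intro r
      rw [RingHom.comp_apply, RingHom.comp_apply, Polynomial.algebraMap_def, Polynomial.coe_mapRingHom,
        Polynomial.map_C, AdjoinRoot.mk_C, AdjoinRoot.mk_C, hψ, hψof]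
    · rw [RingHom.comp_apply, RingHom.comp_apply, Polynomial.algebraMap_def, Polynomial.coe_mapRingHom,
        Polynomial.map_X, AdjoinRoot.mk_X, AdjoinRoot.mk_X, hψ]
      change _ = (AdjoinRoot.lift _ _ hroot) (AdjoinRoot.root g)
      rw [AdjoinRoot.lift_root]
  have H' : RingHom.ker (AdjoinRoot.mk g') ≤
      (RingHom.ker (AdjoinRoot.mk g)).map (algebraMap R[X] (Localization.AtPrime Q)[X]) := by
    have hk : RingHom.ker (AdjoinRoot.mk g) = Ideal.span {g} := Ideal.mk_ker
    have hk' : RingHom.ker (AdjoinRoot.mk g') = Ideal.span {g'} := Ideal.mk_ker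
    rw [hk, hk', Ideal.map_span, Set.image_singleton, Polynomial.algebraMap_def, Polynomial.coe_mapRingHom, ← hg']
  set N : Submonoid (AdjoinRoot g) := ((Q.primeCompl.map (C : R →+* R[X])).map (AdjoinRoot.mk g)) with hN
  haveI hlocC : IsLocalization N (AdjoinRoot g') :=
    IsLocalization.of_surjective _ (Localization.AtPrime Q)[X] (AdjoinRoot.mk g) AdjoinRoot.mk_surjective
      (AdjoinRoot.mk g') AdjoinRoot.mk_surjective H H'
  -- `N` misses `P'`
  have hdisj : Disjoint (N : Set (AdjoinRoot g)) (P' : Set (AdjoinRoot g)) := by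
    rw [Set.disjoint_left]
    rintro _ ⟨_, ⟨x, hx, rfl⟩, rfl⟩ hxP
    apply hx
    have hxQ : x ∈ P'.under R := by
      change algebraMap R (AdjoinRoot g) x ∈ P'
      rw [AdjoinRoot.algebraMap_eq]
      simpa [AdjoinRoot.mk_C] using hxP
    rw [hQ] at hxQ
    exact hxQ
  set P'' : Ideal (AdjoinRoot g') := P'.map (algebraMap (AdjoinRoot g) (AdjoinRoot g')) with hP''
  haveI hP''prime : P''.IsPrime := IsLocalization.isPrime_of_isPrime_disjoint N (AdjoinRoot g') P' inferInstance hdisj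
  have hunder : P''.under (AdjoinRoot g) = P' :=
    IsLocalization.under_map_of_isPrime_disjoint N (AdjoinRoot g') inferInstance hdisj
  -- `B_{P'}` is the localisation of `C` at `P''`
  haveI hTloc : IsLocalization.AtPrime (Localization.AtPrime P'') (P''.under (AdjoinRoot g)) :=
    IsLocalization.isLocalization_isLocalization_atPrime_isLocalization N (Localization.AtPrime P'') P''
  have hpc : (P''.under (AdjoinRoot g)).primeCompl = P'.primeCompl := by
    ext x
    change x ∉ P''.under (AdjoinRoot g) ↔ x ∉ P'
    rw [hunder]
  haveI hTloc' : IsLocalization.AtPrime (Localization.AtPrime P'') P' := by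
    change IsLocalization P'.primeCompl _
    rw [← hpc]
    exact hTloc
  let e₁ : Localization.AtPrime P'' ≃+* Localization.AtPrime P' :=
    (IsLocalization.algEquiv P'.primeCompl (Localization.AtPrime P'') (Localization.AtPrime P')).toRingEquiv
  -- `P''` is the maximal ideal of the local ring `C` (it lies over `Q R_Q`, and `C` is integral over `R_Q`)
  haveI : Algebra.IsIntegral (Localization.AtPrime Q) (AdjoinRoot g') :=
    haveI : Module.Finite (Localization.AtPrime Q) (AdjoinRoot g') := (hgm.map _).finite_adjoinRoot
    inferInstance
  have hP''max : P'' = maximalIdeal (AdjoinRoot g') := by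
    have hne : P'' ≠ ⊤ := hP''prime.ne_top
    have hle : maximalIdeal (Localization.AtPrime Q) ≤ P''.under (Localization.AtPrime Q) := by
      rw [← IsLocalization.AtPrime.map_eq_maximalIdeal Q (Localization.AtPrime Q), Ideal.map_le_iff_le_comap]
      intro x hx
      have hxP' : AdjoinRoot.of g x ∈ P' := by
        have hx' : x ∈ P'.under R := by rw [hQ]; exact hx
        have hx'' : algebraMap R (AdjoinRoot g) x ∈ P' := hx'
        rwa [AdjoinRoot.algebraMap_eq] at hx''
      change algebraMap (Localization.AtPrime Q) (AdjoinRoot g') (algebraMap R (Localization.AtPrime Q) x) ∈ P''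
      rw [AdjoinRoot.algebraMap_eq, ← hψof, ← hψ]
      exact Ideal.mem_map_of_mem _ hxP'
    have hmaxunder : (P''.under (Localization.AtPrime Q)).IsMaximal := by
      have hne' : P''.under (Localization.AtPrime Q) ≠ ⊤ := Ideal.comap_ne_top _ hne
      have heq : maximalIdeal (Localization.AtPrime Q) = P''.under (Localization.AtPrime Q) :=
        (IsLocalRing.maximalIdeal.isMaximal _).eq_of_le hne' hle
      exact heq ▸ IsLocalRing.maximalIdeal.isMaximal _
    have hmax : P''.IsMaximal :=
      Ideal.isMaximal_of_isIntegral_of_isMaximal_comap (R := Localization.AtPrime Q) P'' hmaxunder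
    exact IsLocalRing.eq_maximalIdeal hmax
  -- `C ≅ C_{𝔪_C} = C_{P''}`
  haveI hself : IsLocalization.AtPrime (AdjoinRoot g') (maximalIdeal (AdjoinRoot g')) :=
    IsLocalization.self fun x hx => by
      have hx' : x ∉ maximalIdeal (AdjoinRoot g') := hx
      rwa [mem_maximalIdeal, mem_nonunits_iff, not_not] at hx'
  haveI hP''loc : IsLocalization.AtPrime (Localization.AtPrime P'') (maximalIdeal (AdjoinRoot g')) := by
    have hpc2 : (maximalIdeal (AdjoinRoot g')).primeCompl = P''.primeCompl := by
      ext x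
      change x ∉ maximalIdeal (AdjoinRoot g') ↔ x ∉ P''
      rw [hP''max]
    change IsLocalization (maximalIdeal (AdjoinRoot g')).primeCompl _
    rw [hpc2]
    exact Localization.isLocalization
  let e₂ : AdjoinRoot g' ≃+* Localization.AtPrime P'' :=
    (IsLocalization.algEquiv (maximalIdeal (AdjoinRoot g')).primeCompl (AdjoinRoot g')
      (Localization.AtPrime P'')).toRingEquiv
  constructor
  · intro h
    exact IsRegularLocalRing.of_ringEquiv (e₂.trans e₁).symm
  · intro h
    exact IsRegularLocalRing.of_ringEquiv (e₂.trans e₁)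

/-- **`B_{P'} ≅ R_Q[T]/(T^p − f)` up to regularity.** For `B := R[T]/(T^p − f)` over a ring `R` of characteristic `p`,
a prime `P'` of `B` and `Q := P' ∩ R`: `B_{P'}` is a regular local ring iff the torsor germ `R_Q[T]/(T^p − f)` over the
local ring `R_Q` is (the latter is local by `isLocalRing_adjoinRoot_X_pow_sub_C_of_charP`). OURS (plumbing).
[cite: Matsumura1987, Thm. 19.3] -/
theorem isRegularLocalRing_localization_atPrime_iff_of_under_eq [CharP R p]
    (P' : Ideal (AdjoinRoot ((X : R[X]) ^ p - C f))) [P'.IsPrime] (hQ : P'.under R = Q) :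
    IsRegularLocalRing (Localization.AtPrime P') ↔
      IsRegularLocalRing (AdjoinRoot ((X : (Localization.AtPrime Q)[X]) ^ p -
        C (algebraMap R (Localization.AtPrime Q) f))) := by
  have hgg' : ((X : R[X]) ^ p - C f).map (algebraMap R (Localization.AtPrime Q)) =
      (X : (Localization.AtPrime Q)[X]) ^ p - C (algebraMap R (Localization.AtPrime Q) f) := by
    rw [Polynomial.map_sub, Polynomial.map_pow, Polynomial.map_X, Polynomial.map_C]
  haveI : CharP (Localization.AtPrime Q) p := charP_localization_atPrime p Q
  haveI hCloc : IsLocalRing (AdjoinRoot (((X : R[X]) ^ p - C f).map (algebraMap R (Localization.AtPrime Q)))) := by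
    rw [hgg']
    exact isLocalRing_adjoinRoot_X_pow_sub_C_of_charP p (algebraMap R (Localization.AtPrime Q) f)
  rw [← hgg']
  exact isRegularLocalRing_localization_atPrime_iff_of_monic Q _
    (monic_X_pow_sub_C f (Fact.out : p.Prime).ne_zero) P' hQ

end Localization

/-! ## §3 Non-maximal primes of the torsor germ over a local base -/

section Primes

open Polynomial

variable {R : Type u} [CommRing R] [IsLocalRing R] (p : ℕ) [Fact p.Prime] (f : R)

/-- A NON-maximal prime `P'` of `B = R[T]/(T^p − f)` (`R` local) lies over a non-maximal prime of `R`: `B` is integral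
over `R`. [folklore] -/
theorem under_ne_maximalIdeal_of_exists_lt (P' : Ideal (AdjoinRoot ((X : R[X]) ^ p - C f))) [P'.IsPrime]
    (hP' : ∃ Q' : Ideal (AdjoinRoot ((X : R[X]) ^ p - C f)), Q'.IsPrime ∧ P' < Q') :
    P'.under R ≠ maximalIdeal R := by
  haveI : Module.Finite R (AdjoinRoot ((X : R[X]) ^ p - C f)) :=
    (monic_X_pow_sub_C f (Fact.out : p.Prime).ne_zero).finite_adjoinRoot
  intro h
  have hmax' : (P'.under R).IsMaximal := by rw [h]; exact IsLocalRing.maximalIdeal.isMaximal R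
  have hmax : P'.IsMaximal := Ideal.isMaximal_of_isIntegral_of_isMaximal_comap (R := R) P' hmax'
  obtain ⟨Q', hQ', hlt⟩ := hP'
  exact hlt.ne (hmax.eq_of_le hQ'.ne_top hlt.le)

/-- Conversely (`R` a local domain), every non-maximal prime `Q` of `R` lies under a NON-maximal prime of
`B = R[T]/(T^p − f)` (lying over for the integral injective extension `R → B`). [folklore] -/
theorem exists_prime_under_eq_of_ne_maximalIdeal [IsDomain R] (Q : Ideal R) [Q.IsPrime]
    (hQ : Q ≠ maximalIdeal R) :
    ∃ P' : Ideal (AdjoinRoot ((X : R[X]) ^ p - C f)), P'.IsPrime ∧ P'.under R = Q ∧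
      ∃ Q' : Ideal (AdjoinRoot ((X : R[X]) ^ p - C f)), Q'.IsPrime ∧ P' < Q' := by
  have hp : p.Prime := Fact.out
  haveI : Module.Finite R (AdjoinRoot ((X : R[X]) ^ p - C f)) :=
    (monic_X_pow_sub_C f hp.ne_zero).finite_adjoinRoot
  have hinj : Function.Injective (algebraMap R (AdjoinRoot ((X : R[X]) ^ p - C f))) := by
    rw [AdjoinRoot.algebraMap_eq]
    exact AdjoinRoot.of.injective_of_degree_ne_zero (by
      rw [degree_X_pow_sub_C hp.pos]; exact_mod_cast hp.ne_zero)
  obtain ⟨P', -, hP', hPQ⟩ := Ideal.exists_ideal_over_prime_of_isIntegral Q (⊥ : Ideal (AdjoinRoot ((X : R[X]) ^ p - C f)))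
    (by rw [Ideal.comap_bot_of_injective _ hinj]; exact bot_le)
  haveI := hP'
  have hnotmax : ¬ P'.IsMaximal := fun hm =>
    hQ (IsLocalRing.eq_maximalIdeal (hPQ ▸ Ideal.isMaximal_comap_of_isIntegral_of_isMaximal (R := R) P'))
  obtain ⟨M, hM, hle⟩ := Ideal.exists_le_maximal P' hP'.ne_top
  exact ⟨P', hP', hPQ, M, hM.isPrime, lt_of_le_of_ne hle fun h => hnotmax (h ▸ hM)⟩

end Primes

end Summit.ResolutionOfSingularities.ResolutionOfSingularities.Theorems.SwitchingDichotomy.RadicandLocalization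

end
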